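import Summits.QuantumFields.YangMills.Theorems.BalabanUVNodesN16CentreConventionTransfer
import HarnessLib

/-!
# YM-DAG node N16 (NE3), the located averaging pin (42) ↔ (0.4) — part 32: THE (0.4) SCHEME OF RECORD IS BLOCK-LIFT COVARIANT UNDER `SU(N)`-VALUED COARSE GAUGES —
# the `cov` clause of parts 27′∕29∕31 for `s := step04 F N` with `Γ = SU(N)`-units, on `SU(N)`-valued configurations, DISCHARGED from `Setup.Averaging.covariant`

Cell `pub-ymgap`, width seat `pub-ymgap-dag-n16-w3` (director-ym №197 ∕ HUMAN RULING D-0149), generation 9; part 32 of the W1b lineage (g0's part 0a `…N16AveragingPin`: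
`descendSU`, `step04 F N t = liftCfgOfRecord₁₁ F N t 1 ∘ (avOfRecord F N t 0).avg ∘ descendSU F N t`, `avgIterS`; part 27′ `ApproxSchemeGaugeEquivIn Γ` ∕ part 29 `approx_succ` ∕
part 31 `approx_step42_target_of_steps_sfClass`: their `cov₁` input for the scheme `s`).  `--kind proof --supports stmt-QuantumFields-27366 --as helper` (K3⁸; count-neutral; 0 `def`).

THE POINT.  The averaging OF RECORD `Node00.avOfRecord F N t 0 : Setup.Averaging (F.P t) 0 SU(N)` carries, as a FIELD of the structure, [Balaban1987RG1] p. 253's covariance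
axiom `avg (U^u) = (avg U)^{u ∘ emb}` for every `SU(N)`-valued torus gauge `u` (`Setup.Averaging.covariant`).  Read on the B7 fold through g0's `descendSU` (the `SU(N)`-part,
junk off `SU(N)` — divergence (d1)) and the record's lift, this gives the block-lift covariance clause that parts 27′∕29∕31 display for the scheme `s`, PROVIDED the gauge is
`SU(N)`-valued and the configuration is `SU(N)`-valued (part 23: with `U(N)`-valued gauges the clause is false at order zero):
 * §1 lattice bookkeeping: a site gauge periodic in every coordinate direction is invariant under every period vector (`periodic_add_period_smul`); `toTorusSite₁₁ (x + e_μ) =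
   (toTorusSite₁₁ x).shift μ`; two `ℤ⁴` points over the same torus site carry the same value of a periodic gauge; the section of `Setup.emb y` divided by `L` is the section of `y`
   (`emb` = CENTRE of the block, `n ↦ nL + (L−1)∕2`, Setup's DIVERGENCE F3).
 * §2 `descendSU_gaugeAct` — descending an `SU(N)`-valued `N_t`-periodic `ℤ⁴` gauge transform of an `SU(N)`-valued configuration = the torus gauge transform of the descent;
   `liftCfgOfRecord₁₁_gaugeAct` — lifting a torus gauge transform = the `ℤ⁴` gauge transform of the lift by the lifted gauge.
 * §3 ★★ `step04_gaugeAct_blockLift` — ONE STEP: for `κ` `SU(N)`-valued and `(F.P t).sitesPerDir 1`-periodic and `W` `SU(N)`-valued,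
   `step04 F N t (W^{x ↦ κ(⌊x∕L⌋)}) = (step04 F N t W)^{κ}` (the block-constant gauge read at the centre `emb y` of block `y` is `κ(y)`).
 * §4 ★★★ `avgIterS_step04_gaugeAct_blockLift` — EVERY DEPTH: for `κ` `SU(N)`-valued and `2L^m`-periodic (N16's unit lattice) and `W` `SU(N)`-valued,
   `avgIterS (step04 F N) k (W^{x ↦ κ(⌊x∕L^k⌋)}) = (avgIterS (step04 F N) k W)^{κ}` — the `cov` clause of `ApproxSchemeGaugeEquivIn 4 Γ_SU … (step04 F N) …` ∕ `FineGaugeCov`-free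
   `cov₁` input of part 31's ★★★ for `s := step04 F N`, on ANY class of `SU(N)`-valued configurations, with `Γ_SU := (Node00.ιSU N).range` (`cov_step04_of_range`).
READING (honest).  Pure bookkeeping over a structure field; no estimate.  What remains displayed for the (0.4) side after parts 27–32: the one-step defects `StepNear` (parts 22∕25∕26
give them per bond in a LOCAL exponential gauge — assembling ONE global coarse gauge is the open conversion), the small-field class propagation of `step04`, and the right-inverse
moduli (H2); and the SU(N)-valued sub-class packaging of part 31 (its `sfClass` is `U(N)`-valued).

HONEST FRAMING.  [folklore] bookkeeping BY NAME over `Setup.Averaging.covariant` (a field of the record's averaging structure, [Balaban1987RG1] (a) p. 253), g0's `descendSU`∕`step04`,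
the record's lift `liftCfgOfRecord₁₁` and torus sections `toTorusSite₁₁`; 0 `def`, 0 `sorry`, no `instance`, no `notation`; nothing of Bałaban's estimates asserted; K3⁸ stubs
`stub_rates13HV` ∕ `stub_expansion13HV` NOT touched; N16 ∕ NE3 NOT discharged; count-neutral (typed 28∕28 · discharged 5∕27 work-bound, A 5∕28 — unmoved).  One finite four-torus
programme at fixed `ε` — the Yang–Mills mass gap (Clay) is NOT proved by any of this; R4 closes the conditional finite-𝕋⁴ rung `BalabanLadder.UV` only; nothing continuum ∕ ℝ⁴ ∕ OS.
-/

set_option autoImplicit false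

open scoped BigOperators Matrix Matrix.Norms.L2Operator
open NormedSpace

namespace Summit.QuantumFields.YangMills.BalabanUVNodes.N16Step04BlockLiftCovariance

open Literature.MathematicalPhysics.QuantumFieldTheory.Balaban1983to89
open Literature.MathematicalPhysics.QuantumFieldTheory.Balaban1983to89.T4Continuum (T4Family)
open B7Prop1Explicit B7Prop2Explicit
open Summit.QuantumFields.BalabanUV.T4Continuum
open NE3EnergyShapes (IsUnitarySite IsPeriodicSite)
open Node00 (MatA SU ιSU coe_ιSU cfgOfRecord avOfRecord toTorusSite₁₁ toTorusSite₁₁_apply liftCfgOfRecord₁₁ ne3NperOfRecord₁₁ ne3DomOfRecord₁₁)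
open Summit.QuantumFields.YangMills.BalabanUVNodes.N16AveragingPin (avgIterS avgIterS_succ descendSU step04 ne3NperOfRecord₁₁_mul_pow sitesPerDir_succ_one)
open Summit.QuantumFields.YangMills.BalabanUVNodes.N16AveragingTransferOfGaugeDefect (isPeriodicSite_blockLift)
open Summit.QuantumFields.YangMills.BalabanUVNodes.N16CentreConventionTransfer (natCast_smul_eq_sum_e)

noncomputable section

/-! ## §1 Lattice bookkeeping: periods, torus sections, the centre embedding -/

section Lattice

variable {d : ℕ} {G : Type*}

/-- A site function periodic (period `T`) in every coordinate direction is invariant under `± T·m` steps in one direction. [folklore] -/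
theorem periodic_add_mul_smul_e {u : Site d → G} {T : ℤ} (hu : ∀ (x : Site d) (i : Fin d), u (x + T • e i) = u x) (i : Fin d) :
    ∀ (m : ℤ) (x : Site d), u (x + (m * T) • e i) = u x := by
  have pos : ∀ (m : ℕ) (x : Site d), u (x + ((m : ℤ) * T) • e i) = u x := by
    intro m
    induction m with
    | zero => intro x; simp
    | succ m ih =>
      intro x
      have : x + (((m + 1 : ℕ) : ℤ) * T) • e i = (x + ((m : ℤ) * T) • e i) + T • e i := by
        push_cast; rw [add_mul, one_mul, add_smul, add_assoc]
      rw [this, hu, ih]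
  intro m x
  rcases Int.eq_nat_or_neg m with ⟨n, rfl | rfl⟩
  · exact pos n x
  · have h := pos n (x + ((-(n : ℤ)) * T) • e i)
    rw [add_assoc, ← add_smul, neg_mul, neg_add_cancel, zero_smul, add_zero] at h
    rw [neg_mul]
    exact h.symm

/-- … hence invariant under every period vector `T • v`, `v ∈ ℤ^d` (`T` a natural period). [folklore] -/
theorem periodic_add_period_smul {u : Site d → G} {T : ℕ} (hu : ∀ (x : Site d) (i : Fin d), u (x + (T : ℤ) • e i) = u x) (x v : Site d) :
    u (x + (T : ℤ) • v) = u x := by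
  classical
  rw [natCast_smul_eq_sum_e T v]
  have key : ∀ s : Finset (Fin d), u (x + ∑ κ ∈ s, (v κ * (T : ℤ)) • e κ) = u x := by
    intro s
    induction s using Finset.induction_on with
    | empty => simp
    | insert i s hi ih =>
      rw [Finset.sum_insert hi, ← add_assoc, add_right_comm, periodic_add_mul_smul_e hu i (v i) _, ih]
  exact key Finset.univ

variable {P : Params} {j : ℕ}

/-- One `ℤ^d` step reduces to one torus step: `toTorusSite₁₁ (x + e_μ) = (toTorusSite₁₁ x).shift μ`. [folklore] -/
theorem toTorusSite₁₁_add_e (x : Fin P.d → ℤ) (μ : Fin P.d) : toTorusSite₁₁ P j (x + e μ) = (toTorusSite₁₁ P j x).shift μ := by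
  funext ν
  simp only [toTorusSite₁₁_apply, Site.shift, Function.update_apply, Pi.add_apply, e_apply]
  split_ifs with h
  · subst h; push_cast; rfl
  · simp

/-- A periodic `ℤ^d` gauge takes the same value at two points over the same torus site. [folklore] -/
theorem eq_of_toTorusSite₁₁_eq {u : (Fin P.d → ℤ) → G} (hu : ∀ (x : Fin P.d → ℤ) (i : Fin P.d), u (x + (P.sitesPerDir j : ℤ) • e i) = u x)
    {x x' : Fin P.d → ℤ} (h : toTorusSite₁₁ P j x = toTorusSite₁₁ P j x') : u x = u x' := by
  obtain ⟨v, rfl⟩ := Node00.exists_eq_add_period_smul_of_toTorusSite₁₁_eq h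
  exact (periodic_add_period_smul hu x v).symm

/-- In particular at the section of the torus step: `u (x + e_μ) = u (section ((toTorusSite₁₁ x).shift μ))`. [folklore] -/
theorem apply_add_e_eq_apply_section_shift {u : (Fin P.d → ℤ) → G} (hu : ∀ (x : Fin P.d → ℤ) (i : Fin P.d), u (x + (P.sitesPerDir j : ℤ) • e i) = u x)
    (x : Fin P.d → ℤ) (μ : Fin P.d) : u (x + e μ) = u (fun ν => ((((toTorusSite₁₁ P j x).shift μ) ν).val : ℤ)) :=
  eq_of_toTorusSite₁₁_eq hu (by rw [toTorusSite₁₁_add_e, Node00.toTorusSite₁₁_natCast_val])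

/-- … and at the section of a torus site itself: `u (section (toTorusSite₁₁ x)) = u x`. [folklore] -/
theorem apply_section_toTorusSite₁₁ {u : (Fin P.d → ℤ) → G} (hu : ∀ (x : Fin P.d → ℤ) (i : Fin P.d), u (x + (P.sitesPerDir j : ℤ) • e i) = u x)
    (x : Fin P.d → ℤ) : u (fun ν => (((toTorusSite₁₁ P j x) ν).val : ℤ)) = u x :=
  eq_of_toTorusSite₁₁_eq hu (by rw [Node00.toTorusSite₁₁_natCast_val])

/-- The number of sites per direction one level down is `L` times larger (`j+1 ≤ m+K`). [folklore] -/
theorem sitesPerDir_eq_mul_succ (hj : j + 1 ≤ P.m + P.K) : P.sitesPerDir j = P.L * P.sitesPerDir (j + 1) := by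
  simp only [Params.sitesPerDir]
  have : P.m + P.K - j = (P.m + P.K - (j + 1)) + 1 := by omega
  rw [this, pow_succ]
  ring

/-- **THE CENTRE EMBEDDING IN COORDINATES**: `(emb y)_μ` has least representative `y_μ·L + (L−1)∕2` (`j+1 ≤ m+K`). [folklore] -/
theorem val_emb (hj : j + 1 ≤ P.m + P.K) (y : Site P (j + 1)) (μ : Fin P.d) : ((emb y μ).val : ℤ) = ((y μ).val : ℤ) * P.L + (((P.L - 1) / 2 : ℕ) : ℤ) := by
  have hL : 1 < P.L := P.hL.2
  have hlt : (y μ).val * P.L + (P.L - 1) / 2 < P.sitesPerDir j := by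
    have hy : (y μ).val < P.sitesPerDir (j + 1) := ZMod.val_lt _
    have h2 : (P.L - 1) / 2 < P.L := by omega
    rw [sitesPerDir_eq_mul_succ hj]
    have : (y μ).val * P.L + (P.L - 1) / 2 < ((y μ).val + 1) * P.L := by nlinarith
    calc (y μ).val * P.L + (P.L - 1) / 2 < ((y μ).val + 1) * P.L := this
      _ ≤ P.sitesPerDir (j + 1) * P.L := Nat.mul_le_mul_right _ hy
      _ = P.L * P.sitesPerDir (j + 1) := Nat.mul_comm _ _
  haveI : NeZero (P.sitesPerDir j) := ⟨P.sitesPerDir_ne_zero j⟩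
  have hv : (emb y μ).val = (y μ).val * P.L + (P.L - 1) / 2 := by
    show (((((y μ).val * P.L + (P.L - 1) / 2 : ℕ)) : ZMod (P.sitesPerDir j))).val = _
    rw [ZMod.val_natCast, Nat.mod_eq_of_lt hlt]
  rw [hv]; push_cast; ring

/-- **THE SECTION OF THE CENTRE, DIVIDED BY `L`, IS THE SECTION OF THE COARSE SITE**: `⌊(y_μ L + (L−1)∕2)∕L⌋ = y_μ`. [folklore] -/
theorem section_emb_ediv (hj : j + 1 ≤ P.m + P.K) (y : Site P (j + 1)) :
    (fun μ => ((emb y μ).val : ℤ) / (P.L : ℤ)) = fun μ => ((y μ).val : ℤ) := by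
  have hL : 1 < P.L := P.hL.2
  have hL0 : (0 : ℤ) < (P.L : ℤ) := by exact_mod_cast (by omega : 0 < P.L)
  funext μ
  have h0 : ((((P.L - 1) / 2 : ℕ)) : ℤ) / (P.L : ℤ) = 0 :=
    Int.ediv_eq_zero_of_lt (by positivity) (by exact_mod_cast (by omega : (P.L - 1) / 2 < P.L))
  rw [val_emb hj, add_comm, Int.add_mul_ediv_right _ _ hL0.ne', h0, zero_add]

end Lattice

/-! ## §2 Descending and lifting gauge transformations -/

section DescentLift

variable (F : T4Family) (N : ℕ) [NeZero N]

omit [NeZero N] in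
/-- A unit in the range of `ιSU` IS a special unitary matrix. [folklore] -/
theorem coe_mem_SU_of_mem_range {v : (MatA N)ˣ} (hv : v ∈ (ιSU N).range) : (v : MatA N) ∈ Matrix.specialUnitaryGroup (Fin N) ℂ := by
  obtain ⟨g, rfl⟩ := hv
  rw [coe_ιSU]
  exact g.2

omit [NeZero N] in
/-- … and is the image of the special unitary matrix it is. [folklore] -/
theorem ιSU_mk_coe {v : (MatA N)ˣ} (hv : (v : MatA N) ∈ Matrix.specialUnitaryGroup (Fin N) ℂ) : ιSU N ⟨(v : MatA N), hv⟩ = v :=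
  Units.ext (coe_ιSU N _)

omit [NeZero N] in
/-- The matrix of the inverse unit is the matrix of the inverse in `SU(N)`. [folklore] -/
theorem coe_inv_eq_coe_mk_inv {v : (MatA N)ˣ} (hv : (v : MatA N) ∈ Matrix.specialUnitaryGroup (Fin N) ℂ) :
    ((v⁻¹ : (MatA N)ˣ) : MatA N) = (((⟨(v : MatA N), hv⟩ : SU N)⁻¹ : SU N) : MatA N) := by
  conv_lhs => rw [← ιSU_mk_coe N hv]
  rw [← map_inv, coe_ιSU]

/-- **DESCENT OF A GAUGE TRANSFORM**: for an `SU(N)`-valued configuration `W` and an `SU(N)`-valued `N_t`-periodic gauge `u` of `ℤ⁴` (`N_t = (F.P t).sitesPerDir 0`), the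
`SU(N)`-part descent of `W^u` is the torus gauge transform of the descent of `W` by `u` read at the sections (both `dif` branches literal: every bond variable is in `SU(N)`). [folklore] -/
theorem descendSU_gaugeAct (t : ℕ) {u : (Fin 4 → ℤ) → (MatA N)ˣ} (hu : ∀ x, ((u x : (MatA N)ˣ) : MatA N) ∈ Matrix.specialUnitaryGroup (Fin N) ℂ)
    (huP : ∀ (x : Fin 4 → ℤ) (i : Fin 4), u (x + ((F.P t).sitesPerDir 0 : ℤ) • e i) = u x)
    {W : (Fin 4 → ℤ) → Fin 4 → (MatA N)ˣ} (hW : ∀ x κ, ((W x κ : (MatA N)ˣ) : MatA N) ∈ Matrix.specialUnitaryGroup (Fin N) ℂ) :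
    descendSU F N t (gaugeAct u W) =
      GaugeField.gaugeAct (fun y : Site (F.P t) 0 => (⟨((u (fun μ : Fin 4 => ((y μ).val : ℤ)) : (MatA N)ˣ) : MatA N), hu _⟩ : SU N)) (descendSU F N t W) := by
  funext b
  have hmemW : ((W (fun μ : Fin 4 => ((b.src μ).val : ℤ)) b.dir : (MatA N)ˣ) : MatA N) ∈ Matrix.specialUnitaryGroup (Fin N) ℂ := hW _ _
  -- the end point of the bond: `u (section b.src + e_dir) = u (section b.tgt)` by periodicity
  have hsrc : toTorusSite₁₁ (F.P t) 0 (fun μ : Fin 4 => ((b.src μ).val : ℤ)) = b.src := Node00.toTorusSite₁₁_natCast_val (P := F.P t) (j := 0) b.src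
  have htgt : toTorusSite₁₁ (F.P t) 0 (fun μ : Fin 4 => ((b.tgt μ).val : ℤ)) = b.tgt := Node00.toTorusSite₁₁_natCast_val (P := F.P t) (j := 0) b.tgt
  have hx : toTorusSite₁₁ (F.P t) 0 ((fun μ : Fin 4 => ((b.src μ).val : ℤ)) + e (d := 4) b.dir)
      = (toTorusSite₁₁ (F.P t) 0 (fun μ : Fin 4 => ((b.src μ).val : ℤ))).shift b.dir := toTorusSite₁₁_add_e (P := F.P t) (j := 0) _ _
  have hend : u ((fun μ : Fin 4 => ((b.src μ).val : ℤ)) + e (d := 4) b.dir) = u (fun μ : Fin 4 => ((b.tgt μ).val : ℤ)) :=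
    eq_of_toTorusSite₁₁_eq (P := F.P t) (j := 0) huP (by rw [hx, hsrc, htgt]; rfl)
  set gs : SU N := ⟨((u (fun μ : Fin 4 => ((b.src μ).val : ℤ)) : (MatA N)ˣ) : MatA N), hu _⟩ with hgs
  set gt : SU N := ⟨((u (fun μ : Fin 4 => ((b.tgt μ).val : ℤ)) : (MatA N)ˣ) : MatA N), hu _⟩ with hgt
  set gW : SU N := ⟨((W (fun μ : Fin 4 => ((b.src μ).val : ℤ)) b.dir : (MatA N)ˣ) : MatA N), hmemW⟩ with hgW
  have hval : ((gaugeAct u W (fun μ : Fin 4 => ((b.src μ).val : ℤ)) b.dir : (MatA N)ˣ) : MatA N) = ((gs * gW * gt⁻¹ : SU N) : MatA N) := by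
    simp only [gaugeAct, Units.val_mul]
    rw [hend, coe_inv_eq_coe_mk_inv N (hu _)]
    rfl
  have hmem : ((gaugeAct u W (fun μ : Fin 4 => ((b.src μ).val : ℤ)) b.dir : (MatA N)ˣ) : MatA N) ∈ Matrix.specialUnitaryGroup (Fin N) ℂ := by
    rw [hval]
    exact SetLike.coe_mem _
  have hLHS : descendSU F N t (gaugeAct u W) b = ⟨_, hmem⟩ := by
    unfold descendSU
    rw [dif_pos hmem]
  have hRHS : descendSU F N t W b = gW := by
    unfold descendSU
    rw [dif_pos hmemW]
  rw [hLHS]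
  unfold GaugeField.gaugeAct
  rw [hRHS]
  exact Subtype.ext hval

/-- **LIFT OF A TORUS GAUGE TRANSFORM**: the record's lift of `V^û` is the `ℤ⁴` gauge transform of the lift of `V` by the lifted gauge `x ↦ ιSU (û (toTorusSite₁₁ x))`
(`toTorusSite₁₁ (x + e_κ) = (toTorusSite₁₁ x).shift κ`). [folklore] -/
theorem liftCfgOfRecord₁₁_gaugeAct (K k : ℕ) (uh : GaugeTransf (F.P K) k (SU N)) (V : cfgOfRecord F N K k) :
    liftCfgOfRecord₁₁ F N K k (GaugeField.gaugeAct uh V) =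
      gaugeAct (fun x : Fin 4 → ℤ => ιSU N (uh (toTorusSite₁₁ (F.P K) k x))) (liftCfgOfRecord₁₁ F N K k V) := by
  funext x κ
  have hx : toTorusSite₁₁ (F.P K) k (x + e κ) = (toTorusSite₁₁ (F.P K) k x).shift κ := toTorusSite₁₁_add_e (P := F.P K) x κ
  simp only [Node00.liftCfgOfRecord₁₁_apply, GaugeField.gaugeAct, gaugeAct, map_mul, map_inv, PBond.tgt, hx]

end DescentLift

/-! ## §3 One step: `step04 F N t` is covariant under block lifts of `SU(N)`-valued periodic coarse gauges -/

section OneStep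

variable (F : T4Family) (N : ℕ) [NeZero N]

/-- **★★ ONE STEP**: for `κ` `SU(N)`-valued and `(F.P t).sitesPerDir 1`-periodic (the period of the coarse unit lattice one depth up) and `W` `SU(N)`-valued,
`step04 F N t (W^{x ↦ κ(⌊x∕L⌋)}) = (step04 F N t W)^{κ}`: descend (§2), `Setup.Averaging.covariant` for the averaging OF RECORD ([Balaban1987RG1] (a) p. 253 — a field of the
structure), lift (§2); the block-constant gauge read at the block centre `emb y` is `κ(section y)` (§1 `section_emb_ediv`), and `κ(section (toTorusSite₁₁ x)) = κ x`. [folklore] -/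
theorem step04_gaugeAct_blockLift (t : ℕ) {κ : (Fin 4 → ℤ) → (MatA N)ˣ} (hκ : ∀ x, ((κ x : (MatA N)ˣ) : MatA N) ∈ Matrix.specialUnitaryGroup (Fin N) ℂ)
    (hκP : IsPeriodicSite κ (((F.P t).sitesPerDir 1 : ℕ) : ℤ))
    {W : (Fin 4 → ℤ) → Fin 4 → (MatA N)ˣ} (hW : ∀ x i, ((W x i : (MatA N)ˣ) : MatA N) ∈ Matrix.specialUnitaryGroup (Fin N) ℂ) :
    step04 F N t (gaugeAct (fun x : Fin 4 → ℤ => κ (fun i => x i / (F.L : ℤ))) W) = gaugeAct κ (step04 F N t W) := by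
  have hmK : 0 + 1 ≤ (F.P t).m + (F.P t).K := by have := F.hm; simp only [T4Family.P_m, T4Family.P_K]; omega
  have hNN : (F.P t).sitesPerDir 0 = F.L * (F.P t).sitesPerDir 1 := by
    rw [sitesPerDir_eq_mul_succ (P := F.P t) (j := 0) hmK]; rfl
  -- the block lift is `SU(N)`-valued and `N_t`-periodic
  have hu : ∀ x : Fin 4 → ℤ, (((fun x : Fin 4 → ℤ => κ (fun i => x i / (F.L : ℤ))) x : (MatA N)ˣ) : MatA N) ∈ Matrix.specialUnitaryGroup (Fin N) ℂ :=
    fun x => hκ _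
  have huP : ∀ (x : Fin 4 → ℤ) (i : Fin 4), (fun x : Fin 4 → ℤ => κ (fun i => x i / (F.L : ℤ))) (x + ((F.P t).sitesPerDir 0 : ℤ) • e i)
      = (fun x : Fin 4 → ℤ => κ (fun i => x i / (F.L : ℤ))) x := by
    have h := isPeriodicSite_blockLift (d := 4) F.L (le_of_lt F.hL.2) 1 hκP
    intro x i
    have hx := h x i
    simp only [pow_one] at hx
    rw [hNN, Nat.mul_comm]
    exact hx
  unfold step04
  rw [descendSU_gaugeAct F N t hu huP hW, (avOfRecord F N t 0).covariant hmK, liftCfgOfRecord₁₁_gaugeAct]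
  congr 1
  funext x
  -- the lifted coarse gauge IS `κ`
  rw [ιSU_mk_coe]
  show κ (fun i => ((fun μ : Fin 4 => (((emb (toTorusSite₁₁ (F.P t) 1 x)) μ).val : ℤ)) i) / (F.L : ℤ)) = κ x
  have h1 : (fun i => ((fun μ : Fin 4 => (((emb (toTorusSite₁₁ (F.P t) 1 x)) μ).val : ℤ)) i) / (F.L : ℤ)) =
      fun μ : Fin 4 => (((toTorusSite₁₁ (F.P t) 1 x) μ).val : ℤ) := by
    have h := section_emb_ediv (P := F.P t) (j := 0) hmK (toTorusSite₁₁ (F.P t) 1 x)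
    simp only [T4Family.P_L] at h
    exact h
  rw [h1]
  exact apply_section_toTorusSite₁₁ (P := F.P t) (j := 1) hκP x

end OneStep

/-! ## §4 Every depth: the `cov` clause for `s := step04 F N` with `SU(N)`-valued coarse gauges on `SU(N)`-valued configurations -/

section AllDepths

variable (F : T4Family) (N : ℕ) [NeZero N]

/-- Iterated integer division: `⌊⌊x∕L⌋∕L^k⌋ = ⌊x∕L^{k+1}⌋`. [folklore] -/
theorem ediv_ediv_pow (L : ℕ) (x : ℤ) (k : ℕ) : x / (L : ℤ) / (L : ℤ) ^ k = x / (L : ℤ) ^ (k + 1) := by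
  rw [Int.ediv_ediv_of_nonneg (by positivity : (0 : ℤ) ≤ (L : ℤ)), pow_succ']

/-- The `k`-fold (0.4)-average of record of an `SU(N)`-valued configuration is `SU(N)`-valued (it is a lift of a torus `SU(N)` field). [folklore] -/
theorem coe_avgIterS_step04_mem (k : ℕ) {W : (Fin 4 → ℤ) → Fin 4 → (MatA N)ˣ}
    (hW : ∀ x i, ((W x i : (MatA N)ˣ) : MatA N) ∈ Matrix.specialUnitaryGroup (Fin N) ℂ) (x : Fin 4 → ℤ) (i : Fin 4) :
    ((avgIterS (step04 F N) k W x i : (MatA N)ˣ) : MatA N) ∈ Matrix.specialUnitaryGroup (Fin N) ℂ := by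
  induction k generalizing W with
  | zero => exact hW x i
  | succ k ih =>
    rw [avgIterS_succ]
    refine ih (fun y μ => ?_)
    unfold step04
    rw [Node00.coe_liftCfgOfRecord₁₁_apply]
    exact SetLike.coe_mem _

/-- **★★★ EVERY DEPTH**: for `κ` `SU(N)`-valued and `2L^m`-periodic (N16's unit lattice, `ne3NperOfRecord₁₁ F 0 0`) and `W` `SU(N)`-valued,
`avgIterS (step04 F N) k (W^{x ↦ κ(⌊x∕L^k⌋)}) = (avgIterS (step04 F N) k W)^{κ}` — induction on the depth with §3 at the coarse gauge `x ↦ κ(⌊x∕L^k⌋)` (period `2L^m·L^k =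
(F.P (k+1)).sitesPerDir 1`). [folklore] -/
theorem avgIterS_step04_gaugeAct_blockLift : ∀ (k : ℕ) {κ : (Fin 4 → ℤ) → (MatA N)ˣ},
    (∀ x, ((κ x : (MatA N)ˣ) : MatA N) ∈ Matrix.specialUnitaryGroup (Fin N) ℂ) → IsPeriodicSite κ ((ne3NperOfRecord₁₁ F 0 0 : ℕ) : ℤ) →
    ∀ {W : (Fin 4 → ℤ) → Fin 4 → (MatA N)ˣ}, (∀ x i, ((W x i : (MatA N)ˣ) : MatA N) ∈ Matrix.specialUnitaryGroup (Fin N) ℂ) →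
    avgIterS (step04 F N) k (gaugeAct (fun x : Fin 4 → ℤ => κ (fun i => x i / (F.L : ℤ) ^ k)) W) = gaugeAct κ (avgIterS (step04 F N) k W)
  | 0, κ, _, _, W, _ => by
    show gaugeAct (fun x : Fin 4 → ℤ => κ (fun i => x i / (F.L : ℤ) ^ 0)) W = gaugeAct κ W
    simp only [pow_zero, Int.ediv_one]
  | k + 1, κ, hκ, hκP, W, hW => by
    rw [avgIterS_succ, avgIterS_succ]
    -- the depth-`k` coarse gauge `x ↦ κ(⌊x∕L^k⌋)`: `SU(N)`-valued, period `2L^m L^k = (F.P (k+1)).sitesPerDir 1`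
    have hκk : ∀ x, (((fun x : Fin 4 → ℤ => κ (fun i => x i / (F.L : ℤ) ^ k)) x : (MatA N)ˣ) : MatA N) ∈ Matrix.specialUnitaryGroup (Fin N) ℂ := fun x => hκ _
    have hper : ((F.P (k + 1)).sitesPerDir 1 : ℕ) = ne3NperOfRecord₁₁ F 0 0 * F.L ^ k := by
      rw [sitesPerDir_succ_one, ← ne3NperOfRecord₁₁_mul_pow]
    have hκkP : IsPeriodicSite (fun x : Fin 4 → ℤ => κ (fun i => x i / (F.L : ℤ) ^ k)) (((F.P (k + 1)).sitesPerDir 1 : ℕ) : ℤ) := by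
      rw [hper]
      exact isPeriodicSite_blockLift (d := 4) F.L (le_of_lt F.hL.2) k hκP
    have hlift : (fun x : Fin 4 → ℤ => κ (fun i => x i / (F.L : ℤ) ^ (k + 1)))
        = fun x : Fin 4 → ℤ => (fun x : Fin 4 → ℤ => κ (fun i => x i / (F.L : ℤ) ^ k)) (fun i => x i / (F.L : ℤ)) := by
      funext x
      simp only [ediv_ediv_pow]
    rw [hlift, step04_gaugeAct_blockLift F N (k + 1) hκk hκkP hW]
    exact avgIterS_step04_gaugeAct_blockLift k hκ hκP (fun y μ => by
      unfold step04
      rw [Node00.coe_liftCfgOfRecord₁₁_apply]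
      exact SetLike.coe_mem _)

/-- **THE `cov` CLAUSE OF PARTS 27′∕29∕31 FOR `s := step04 F N` WITH `Γ_SU := (ιSU N).range`**, on every class `C` of `SU(N)`-valued configurations (e.g. `SU(N)`-valued sub-classes of
`sfClass 4 F.L (2L^m) ε k`, or N16's data `ne3DomOfRecord₁₁`): block lifts of `Γ_SU`-valued `2L^m`-periodic coarse gauges move the `k`-fold (0.4)-average of record covariantly. [folklore] -/
theorem cov_step04_of_range (k : ℕ) {C : Set ((Fin 4 → ℤ) → Fin 4 → (MatA N)ˣ)} (hC : ∀ U ∈ C, ∀ x i, U x i ∈ (ιSU N).range)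
    (κ : (Fin 4 → ℤ) → (MatA N)ˣ) (U : (Fin 4 → ℤ) → Fin 4 → (MatA N)ˣ) (hκ : ∀ x, κ x ∈ (ιSU N).range)
    (hκP : IsPeriodicSite κ ((ne3NperOfRecord₁₁ F 0 0 : ℕ) : ℤ)) (hU : U ∈ C) :
    avgIterS (step04 F N) k (gaugeAct (fun x : Fin 4 → ℤ => κ (fun i => x i / (F.L : ℤ) ^ k)) U) = gaugeAct κ (avgIterS (step04 F N) k U) :=
  avgIterS_step04_gaugeAct_blockLift F N k (fun x => coe_mem_SU_of_mem_range N (hκ x)) hκP (fun x i => coe_mem_SU_of_mem_range N (hC U hU x i))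

omit [NeZero N] in
/-- The `SU(N)`-valued units form a subgroup of the unitary units (`Γ_SU ≤ unitaryUnits`: the `hΓ` input of parts 27′∕29∕31). [folklore] -/
theorem range_ιSU_le_unitaryUnits : (ιSU N).range ≤ unitaryUnits (MatA N) := by
  rintro v ⟨g, rfl⟩
  exact mem_unitaryUnits.mpr (by rw [coe_ιSU]; exact Matrix.specialUnitaryGroup_le_unitaryGroup g.2)

end AllDepths

end

end Summit.QuantumFields.YangMills.BalabanUVNodes.N16Step04BlockLiftCovariance
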